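import Mathlib

/-!
# ChartedPlanarOrder — line KPERT step (L-a): two local templates matched to the same cloud are CLOSE AS POINT SETS on the overlap
(DEF-FREE metric-space helper; lens-3 g19)

In the registered `matchedAt η μ x` text a template `T` (placed at `x`) is two-way `η`-matched to the cloud `S = {p | μ {p} ≠ 0}`:
(i) every cloud point within `4b` of `x` has a `T`-point within `η`; (ii) every `T`-point within `5b` of `x` has a cloud point within `η`.
If `T` is matched at `x` (clause (ii), radius `R`) and `T'` at `x'` (clause (i), radius `R'`), then every `T`-point `t` with `dist t x ≤ R` and
`dist t x' + η ≤ R'` has a `T'`-point within `η + η'` — the triangle inequality through the common cloud partner.  This is ALL the template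
"rigidity" the sitewise bond-length expansion of KPERT needs (energies see point sets, not template parameters); PARAMETER rigidity
(b, frame, gaps, letters — census TAG 127) matters for the drift questions of line P-b, not for KPERT.  Pure metric-space algebra; no `def`.
-/

namespace Summit.AtomisticToContinuum.Crystallization.Theorems.ChartedPlanarOrderTemplateOverlap

variable {X : Type*} [PseudoMetricSpace X]

/-- **overlap closeness.** `T` has cloud partners near `x` (radius `R`, tolerance `η`), the cloud has `T'`-partners near `x'` (radius `R'`,
tolerance `η'`) ⟹ every `T`-point in the overlap has a `T'`-point within `η + η'`. -/
theorem exists_close_of_two_matchings {S T T' : Set X} {x x' : X} {R R' η η' : ℝ}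
    (hT : ∀ t ∈ T, dist t x ≤ R → ∃ s ∈ S, dist s t ≤ η)
    (hT' : ∀ s ∈ S, dist s x' ≤ R' → ∃ t' ∈ T', dist s t' ≤ η')
    {t : X} (ht : t ∈ T) (htx : dist t x ≤ R) (htx' : dist t x' + η ≤ R') :
    ∃ t' ∈ T', dist t t' ≤ η + η' := by
  obtain ⟨s, hs, hst⟩ := hT t ht htx
  have hsx' : dist s x' ≤ R' := by
    have := dist_triangle s t x'
    linarith
  obtain ⟨t', ht', hst'⟩ := hT' s hs hsx'
  refine ⟨t', ht', ?_⟩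
  have := dist_triangle t s t'
  rw [dist_comm t s] at this
  linarith

/-- the same with the cloud given as a predicate `P` (the registered texts use `μ {p} ≠ 0`) and the partner inequality written
`dist p t ≤ η` / `∃ p, P p ∧ dist p t' ≤ η'` exactly as in the `matchedAt` clauses. -/
theorem exists_close_of_two_matchings' {P : X → Prop} {T T' : Set X} {x x' : X} {R R' η η' : ℝ}
    (hT : ∀ t ∈ T, dist t x ≤ R → ∃ p, P p ∧ dist p t ≤ η)
    (hT' : ∀ p, dist p x' ≤ R' → P p → ∃ t' ∈ T', dist p t' ≤ η')
    {t : X} (ht : t ∈ T) (htx : dist t x ≤ R) (htx' : dist t x' + η ≤ R') :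
    ∃ t' ∈ T', dist t t' ≤ η + η' := by
  refine exists_close_of_two_matchings (S := {p | P p}) (fun u hu hux => ?_) (fun s hs hsx' => hT' s hsx' hs) ht htx htx'
  obtain ⟨p, hp, hpu⟩ := hT u hu hux
  exact ⟨p, hp, hpu⟩

/-- symmetric two-sided form: on the common overlap the two templates are within `η + η'` of each other in BOTH directions
(Hausdorff-type closeness of `T ∩ overlap` and `T' ∩ overlap`). -/
theorem two_matchings_close_both_ways {S T T' : Set X} {x x' : X} {R₁ R₂ R₁' R₂' η η' : ℝ}
    (hT₁ : ∀ s ∈ S, dist s x ≤ R₁ → ∃ t ∈ T, dist s t ≤ η)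
    (hT₂ : ∀ t ∈ T, dist t x ≤ R₂ → ∃ s ∈ S, dist s t ≤ η)
    (hT₁' : ∀ s ∈ S, dist s x' ≤ R₁' → ∃ t' ∈ T', dist s t' ≤ η')
    (hT₂' : ∀ t' ∈ T', dist t' x' ≤ R₂' → ∃ s ∈ S, dist s t' ≤ η') :
    (∀ t ∈ T, dist t x ≤ R₂ → dist t x' + η ≤ R₁' → ∃ t' ∈ T', dist t t' ≤ η + η') ∧
    (∀ t' ∈ T', dist t' x' ≤ R₂' → dist t' x + η' ≤ R₁ → ∃ t ∈ T, dist t' t ≤ η' + η) :=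
  ⟨fun _ ht htx htx' => exists_close_of_two_matchings hT₂ hT₁' ht htx htx',
   fun _ ht' ht'x' ht'x => exists_close_of_two_matchings hT₂' hT₁ ht' ht'x' ht'x⟩

end Summit.AtomisticToContinuum.Crystallization.Theorems.ChartedPlanarOrderTemplateOverlap
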